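import Mathlib
import HarnessLib
import Summits.HubbardSuperconductivity.HubbardSuperconductivity.Theorems.KLProgrammeKLRegimeSplitTwoLegReadingTube
import Summits.HubbardSuperconductivity.HubbardSuperconductivity.Theorems.KLProgrammeKLRegimeSplitTwoLegCoreTDZero
import Summits.HubbardSuperconductivity.HubbardSuperconductivity.Theorems.KLProgrammeKLRegimeSplitTwoLegFrameLipschitzLiteral

/-!
# Route `KLProgramme` — GEN-6 ENGINE (`KLRegimeEngineV16`, stmt-HubbardSuperconductivity-20236), two-leg stubs: the capped (E3c)
# `FrameLipschitzFnTD … K n` in TWO REGIMES — near comparison frames by a TUBE gradient and a near response, far ones by VALUE sizes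

Cell `gate-hubbard-kl`, seat p1b (g7).  The (E3c) closers of record (`frameLipschitzFnTD_zero_of_responses`, `…_succ_of_increment_responses`) split
`Δℓ_n(θ) = [F^K](k_F^K θ) − [F^{K′}](k_F^{K′} θ)` (`F^K` = the scale-0 reading `S₀^K − K`, or the increment `S_{n+1}^K − S_n^K`) into the motion of the
reading point (a GLOBAL gradient of `F^K`) and the response at `k_F^{K′}θ` — for EVERY capped comparison frame `K′`.  For comparison frames far from
`K` (`frameDist K K′ ≳ Λ_n`, admissible: the class has `frameDist` up to `≈ (8/3)Gfr₀|U|`) the point `k_F^{K′}θ` leaves the flat tube of `K`'s scale-`n`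
cutoff, and both terms pick up the unrenormalised counterterm chain (k3c5-p1 g7's finding, 07:54:22Z; p1b 08:10:36Z (b)).  The cure, consumer side:

* NEAR (`frameDist K K′ ≤ d`): both Fermi points lie on the ray `θ`, and the radial segment between them lies in the level tube
  `{|e_K| ≤ frameDist K K′}` (`…TwoLegReadingTube.abs_apply_klFermiPoint_sub_le_of_frames_of_tube`) — so the gradient of `F^K` is needed ONLY on
  `{|frameLevel μ K| ≤ d}`, and the response only for near `K′`;
* FAR (`d < frameDist K K′`): `|Δℓ_n(θ)| ≤ |F^K(k_F^K θ)| + |F^{K′}(k_F^{K′} θ)| ≤ 2v ≤ lipBar·d < lipBar·frameDist K K′` from the VALUE sizes of both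
  profiles (the j = 0 tier-1 size, read on each frame's own curve — chain-free) and ONE package inequality `2v ≤ lipBar G Q U n · d`.

§1 the profile-difference lemmas (near / far) at scale `0` and `n+1`; §2 the closers **`frameLipschitzFnTD_zero_of_nearFar`**, **`frameLipschitzFnTD_succ_of_nearFar`**
(named thresholds `klCurveC3 / klCurveU0`; hypotheses: tube gradient `b`, near response `ρ`, value size `v` for `K` and for every capped `K′` with history,
`0 < d`, fits `ρ + b/klCurveD ≤ lipBar G Q U n`, `2v ≤ lipBar G Q U n · d`).

Proofs only; nothing about the model is asserted.  References: BGM 2006 §2.4 Lemma 2.1 (2.40), (2.36) [cite: BenfattoGiulianiMastropietro2006].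
-/

noncomputable section

namespace Summit.HubbardSuperconductivity.HubbardSuperconductivity.Theorems.KLRegimeSplit

set_option linter.dupNamespace false -- summit = problem name (single-conjunct summit), D-0017

open Real Set MeasureTheory
open Literature.MathematicalPhysics.QuantumLattice Literature.MathematicalPhysics.QuantumLattice.BandSectorCounting
open Literature.Probability.LatticeModels
open Summit.HubbardSuperconductivity.HubbardSuperconductivity.Theorems.DispersionFlow
open Summit.HubbardSuperconductivity.HubbardSuperconductivity.Theorems.PerturbedFermiCurve
open Summit.HubbardSuperconductivity.HubbardSuperconductivity.Theorems.KLProgrammeLegKernels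

/-! ## §1 The profile differences: near (tube gradient + response) and far (value sizes) -/

section Profiles

variable {L M : ℕ} [NeZero L] [NeZero M]
variable {a b : ℝ} (B : BandBounds a b) {K K' : TrigPolyC4v} {A : ℝ}
  (hA : ∀ p : Momentum, ∀ j ≤ 2, ‖iteratedFDeriv ℝ j (frameShift K) p‖ ≤ A)
  (hA' : ∀ p : Momentum, ∀ j ≤ 2, ‖iteratedFDeriv ℝ j (frameShift K') p‖ ≤ A)
  (hADt : 2 * A < B.Dtmin) {μ : ℝ} (hlo : a ≤ μ - A) (hhi : μ + A ≤ b)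
include B hA hA' hADt hlo hhi

omit hA' in
/-- Continuity of the scale-`m` local part and of the frame read on its own curve (frame hypotheses). -/
theorem continuous_klLocalPart_and_frameOnCurve (β U : ℝ) (m : ℕ) :
    Continuous (klLocalPart L M β U μ K m) ∧ Continuous (fun θ => K.eval (klFermiPoint μ K θ)) :=
  ⟨(contDiff_klLocalPart B hA hADt hlo hhi L M β U m (m := 0)).continuous,
    (contDiff_eval_klFermiPoint B hA hADt hlo hhi K (m := 0)).continuous⟩

/-- **Scale `0`, NEAR**: with `T^X := S₀^X − X`, a gradient bound `‖D(evalM S₀^K − evalM K) q‖ ≤ b₀` on the tube `{|frameLevel μ K q| ≤ frameDist K K′}` and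
the response `|T^K(k_F^{K′}θ) − T^{K′}(k_F^{K′}θ)| ≤ r₀`: `|ℓ₀(K) q − ℓ₀(K′) q| ≤ r₀ + b₀·frameDist K K′/(Dt_min − 2A)`. -/
theorem abs_klTwoLegPieceFn_eval_zero_sub_le_near {β U : ℝ} {b₀ r₀ : ℝ} (hb₀ : 0 ≤ b₀)
    (hgrad₀ : ∀ q : Momentum, |frameLevel μ K q| ≤ frameDist K K' → ‖fderiv ℝ (fun q : Momentum =>
      evalM (symInterp L (klLocSelfEnergyRe L M β U μ K 0)) q - evalM K q) q‖ ≤ b₀)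
    (hresp₀ : ∀ θ : ℝ,
      |((symInterp L (klLocSelfEnergyRe L M β U μ K 0)).eval (klFermiPoint μ K' θ) - K.eval (klFermiPoint μ K' θ)) -
        ((symInterp L (klLocSelfEnergyRe L M β U μ K' 0)).eval (klFermiPoint μ K' θ) - K'.eval (klFermiPoint μ K' θ))| ≤ r₀)
    (q : Fin 2 → ℝ) :
    |klTwoLegPieceFn L M β U μ K.eval 0 q - klTwoLegPieceFn L M β U μ K'.eval 0 q| ≤ r₀ + b₀ * (frameDist K K' / (B.Dtmin - 2 * A)) := by
  set FK : FrameFn := fun p => (symInterp L (klLocSelfEnergyRe L M β U μ K 0)).eval p - K.eval p with hFK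
  set FK' : FrameFn := fun p => (symInterp L (klLocSelfEnergyRe L M β U μ K' 0)).eval p - K'.eval p with hFK'
  obtain ⟨hcK, hcKc⟩ := continuous_klLocalPart_and_frameOnCurve B hA hADt hlo hhi (K := K) (L := L) (M := M) β U 0
  obtain ⟨hcK', hcK'c⟩ := continuous_klLocalPart_and_frameOnCurve B hA' hADt hlo hhi (K := K') (L := L) (M := M) β U 0
  rw [klTwoLegPieceFn_eval_zero β U μ K hcK hcKc, klTwoLegPieceFn_eval_zero β U μ K' hcK' hcK'c]
  have hdiff : Differentiable ℝ (onM FK) := by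
    have h : onM FK = fun q => evalM (symInterp L (klLocSelfEnergyRe L M β U μ K 0)) q - evalM K q := rfl
    rw [h]; exact (differentiable_evalM _).sub (differentiable_evalM K)
  have hgrad' : ∀ q : Momentum, |frameLevel μ K q| ≤ frameDist K K' → ‖fderiv ℝ (onM FK) q‖ ≤ b₀ := hgrad₀
  have hprof : ∀ θ, |(klLocalPart L M β U μ K 0 θ - K.eval (klFermiPoint μ K θ)) -
      (klLocalPart L M β U μ K' 0 θ - K'.eval (klFermiPoint μ K' θ))| ≤ r₀ + b₀ * (frameDist K K' / (B.Dtmin - 2 * A)) := by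
    intro θ
    have h := abs_apply_klFermiPoint_sub_le_of_frames_of_tube B hA hA' hADt hlo hhi FK FK' hdiff hb₀ θ hgrad'
    have h2 : |FK (klFermiPoint μ K' θ) - FK' (klFermiPoint μ K' θ)| ≤ r₀ := by simpa only [hFK, hFK'] using hresp₀ θ
    have h3 : (klLocalPart L M β U μ K 0 θ - K.eval (klFermiPoint μ K θ)) - (klLocalPart L M β U μ K' 0 θ - K'.eval (klFermiPoint μ K' θ)) =
        FK (klFermiPoint μ K θ) - FK' (klFermiPoint μ K' θ) := rfl
    rw [h3]
    linarith
  exact abs_klFrameExtFn_sub_klFrameExtFn_le μ ((hcK.sub hcKc).intervalIntegrable _ _) ((hcK'.sub hcK'c).intervalIntegrable _ _) hprof q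

/-- **Scale `0`, FAR**: from the value sizes of both profiles, `|ℓ₀(K) q − ℓ₀(K′) q| ≤ v + v′`. -/
theorem abs_klTwoLegPieceFn_eval_zero_sub_le_far {β U : ℝ} {v v' : ℝ}
    (hv : ∀ θ : ℝ, |(symInterp L (klLocSelfEnergyRe L M β U μ K 0)).eval (klFermiPoint μ K θ) - K.eval (klFermiPoint μ K θ)| ≤ v)
    (hv' : ∀ θ : ℝ, |(symInterp L (klLocSelfEnergyRe L M β U μ K' 0)).eval (klFermiPoint μ K' θ) - K'.eval (klFermiPoint μ K' θ)| ≤ v')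
    (q : Fin 2 → ℝ) :
    |klTwoLegPieceFn L M β U μ K.eval 0 q - klTwoLegPieceFn L M β U μ K'.eval 0 q| ≤ v + v' := by
  obtain ⟨hcK, hcKc⟩ := continuous_klLocalPart_and_frameOnCurve B hA hADt hlo hhi (K := K) (L := L) (M := M) β U 0
  obtain ⟨hcK', hcK'c⟩ := continuous_klLocalPart_and_frameOnCurve B hA' hADt hlo hhi (K := K') (L := L) (M := M) β U 0
  rw [klTwoLegPieceFn_eval_zero β U μ K hcK hcKc, klTwoLegPieceFn_eval_zero β U μ K' hcK' hcK'c]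
  have hprof : ∀ θ, |(klLocalPart L M β U μ K 0 θ - K.eval (klFermiPoint μ K θ)) -
      (klLocalPart L M β U μ K' 0 θ - K'.eval (klFermiPoint μ K' θ))| ≤ v + v' := fun θ =>
    (abs_sub _ _).trans (add_le_add (hv θ) (hv' θ))
  exact abs_klFrameExtFn_sub_klFrameExtFn_le μ ((hcK.sub hcKc).intervalIntegrable _ _) ((hcK'.sub hcK'c).intervalIntegrable _ _) hprof q

/-- **Scale `n+1`, NEAR**: with `F^X := S_{n+1}^X − S_n^X`, a gradient bound on the tube `{|frameLevel μ K q| ≤ frameDist K K′}` and the increment response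
`|F^K(k_F^{K′}θ) − F^{K′}(k_F^{K′}θ)| ≤ r_Δ`: `|ℓ_{n+1}(K) q − ℓ_{n+1}(K′) q| ≤ r_Δ + b_Δ·frameDist K K′/(Dt_min − 2A)`. -/
theorem abs_klTwoLegPieceFn_eval_succ_sub_le_near {β U : ℝ} {n : ℕ} {bΔ rΔ : ℝ} (hbΔ : 0 ≤ bΔ)
    (hgrad : ∀ q : Momentum, |frameLevel μ K q| ≤ frameDist K K' → ‖fderiv ℝ (fun q : Momentum =>
      evalM (symInterp L (klLocSelfEnergyRe L M β U μ K (n + 1))) q - evalM (symInterp L (klLocSelfEnergyRe L M β U μ K n)) q) q‖ ≤ bΔ)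
    (hresp : ∀ θ : ℝ,
      |((symInterp L (klLocSelfEnergyRe L M β U μ K (n + 1))).eval (klFermiPoint μ K' θ) -
          (symInterp L (klLocSelfEnergyRe L M β U μ K n)).eval (klFermiPoint μ K' θ)) -
        ((symInterp L (klLocSelfEnergyRe L M β U μ K' (n + 1))).eval (klFermiPoint μ K' θ) -
          (symInterp L (klLocSelfEnergyRe L M β U μ K' n)).eval (klFermiPoint μ K' θ))| ≤ rΔ)
    (q : Fin 2 → ℝ) :
    |klTwoLegPieceFn L M β U μ K.eval (n + 1) q - klTwoLegPieceFn L M β U μ K'.eval (n + 1) q| ≤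
      rΔ + bΔ * (frameDist K K' / (B.Dtmin - 2 * A)) := by
  set FK : FrameFn := fun p => (symInterp L (klLocSelfEnergyRe L M β U μ K (n + 1))).eval p -
    (symInterp L (klLocSelfEnergyRe L M β U μ K n)).eval p with hFK
  set FK' : FrameFn := fun p => (symInterp L (klLocSelfEnergyRe L M β U μ K' (n + 1))).eval p -
    (symInterp L (klLocSelfEnergyRe L M β U μ K' n)).eval p with hFK'
  have hc1 := (continuous_klLocalPart_and_frameOnCurve B hA hADt hlo hhi (K := K) (L := L) (M := M) β U (n + 1)).1
  have hc0 := (continuous_klLocalPart_and_frameOnCurve B hA hADt hlo hhi (K := K) (L := L) (M := M) β U n).1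
  have hc1' := (continuous_klLocalPart_and_frameOnCurve B hA' hADt hlo hhi (K := K') (L := L) (M := M) β U (n + 1)).1
  have hc0' := (continuous_klLocalPart_and_frameOnCurve B hA' hADt hlo hhi (K := K') (L := L) (M := M) β U n).1
  rw [klTwoLegPieceFn_eval_succ β U μ K n hc1 hc0, klTwoLegPieceFn_eval_succ β U μ K' n hc1' hc0']
  have hdiff : Differentiable ℝ (onM FK) := by
    have h : onM FK = fun q => evalM (symInterp L (klLocSelfEnergyRe L M β U μ K (n + 1))) q -
        evalM (symInterp L (klLocSelfEnergyRe L M β U μ K n)) q := rfl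
    rw [h]; exact (differentiable_evalM _).sub (differentiable_evalM _)
  have hgrad' : ∀ q : Momentum, |frameLevel μ K q| ≤ frameDist K K' → ‖fderiv ℝ (onM FK) q‖ ≤ bΔ := hgrad
  have hprof : ∀ θ, |(klLocalPart L M β U μ K (n + 1) θ - klLocalPart L M β U μ K n θ) -
      (klLocalPart L M β U μ K' (n + 1) θ - klLocalPart L M β U μ K' n θ)| ≤ rΔ + bΔ * (frameDist K K' / (B.Dtmin - 2 * A)) := by
    intro θ
    have h := abs_apply_klFermiPoint_sub_le_of_frames_of_tube B hA hA' hADt hlo hhi FK FK' hdiff hbΔ θ hgrad'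
    have h2 : |FK (klFermiPoint μ K' θ) - FK' (klFermiPoint μ K' θ)| ≤ rΔ := by simpa only [hFK, hFK'] using hresp θ
    have h3 : (klLocalPart L M β U μ K (n + 1) θ - klLocalPart L M β U μ K n θ) -
        (klLocalPart L M β U μ K' (n + 1) θ - klLocalPart L M β U μ K' n θ) = FK (klFermiPoint μ K θ) - FK' (klFermiPoint μ K' θ) := rfl
    rw [h3]
    linarith
  exact abs_klFrameExtFn_sub_klFrameExtFn_le μ ((hc1.sub hc0).intervalIntegrable _ _) ((hc1'.sub hc0').intervalIntegrable _ _) hprof q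

/-- **Scale `n+1`, FAR**: `|ℓ_{n+1}(K) q − ℓ_{n+1}(K′) q| ≤ v + v′` from the value sizes of both increment profiles. -/
theorem abs_klTwoLegPieceFn_eval_succ_sub_le_far {β U : ℝ} {n : ℕ} {v v' : ℝ}
    (hv : ∀ θ : ℝ, |(symInterp L (klLocSelfEnergyRe L M β U μ K (n + 1))).eval (klFermiPoint μ K θ) -
      (symInterp L (klLocSelfEnergyRe L M β U μ K n)).eval (klFermiPoint μ K θ)| ≤ v)
    (hv' : ∀ θ : ℝ, |(symInterp L (klLocSelfEnergyRe L M β U μ K' (n + 1))).eval (klFermiPoint μ K' θ) -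
      (symInterp L (klLocSelfEnergyRe L M β U μ K' n)).eval (klFermiPoint μ K' θ)| ≤ v')
    (q : Fin 2 → ℝ) :
    |klTwoLegPieceFn L M β U μ K.eval (n + 1) q - klTwoLegPieceFn L M β U μ K'.eval (n + 1) q| ≤ v + v' := by
  have hc1 := (continuous_klLocalPart_and_frameOnCurve B hA hADt hlo hhi (K := K) (L := L) (M := M) β U (n + 1)).1
  have hc0 := (continuous_klLocalPart_and_frameOnCurve B hA hADt hlo hhi (K := K) (L := L) (M := M) β U n).1
  have hc1' := (continuous_klLocalPart_and_frameOnCurve B hA' hADt hlo hhi (K := K') (L := L) (M := M) β U (n + 1)).1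
  have hc0' := (continuous_klLocalPart_and_frameOnCurve B hA' hADt hlo hhi (K := K') (L := L) (M := M) β U n).1
  rw [klTwoLegPieceFn_eval_succ β U μ K n hc1 hc0, klTwoLegPieceFn_eval_succ β U μ K' n hc1' hc0']
  have hprof : ∀ θ, |(klLocalPart L M β U μ K (n + 1) θ - klLocalPart L M β U μ K n θ) -
      (klLocalPart L M β U μ K' (n + 1) θ - klLocalPart L M β U μ K' n θ)| ≤ v + v' := fun θ =>
    (abs_sub _ _).trans (add_le_add (hv θ) (hv' θ))
  exact abs_klFrameExtFn_sub_klFrameExtFn_le μ ((hc1.sub hc0).intervalIntegrable _ _) ((hc1'.sub hc0').intervalIntegrable _ _) hprof q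

end Profiles

/-! ## §2 The two-regime (E3c) closers in the KL regime (named thresholds) -/

section Model

variable {L M : ℕ} [NeZero L] [NeZero M]

/-- **CAPPED (E3c) FOR `ℓ_0` IN TWO REGIMES.**  Inputs: a gradient bound `b₀` of `evalM S₀ᴷ − evalM K` on the TUBE `{|frameLevel μ K q| ≤ d}`; the response
`ρ₀·frameDist K K′` of `T = S₀ − (frame)` at `k_F^{K′}θ` for the NEAR capped comparison frames (`frameDist K K′ ≤ d`); the VALUE size `v` of `T^K` on `K`'s
curve and of `T^{K′}` on `K′`'s curve for every capped `K′`; `0 < d`; fits `ρ₀ + b₀/klCurveD ≤ lipBar G Q U 0` and `2v ≤ lipBar G Q U 0 · d`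
⇒ `FrameLipschitzFnTD L M hist G Q R β U μ K 0`. -/
theorem frameLipschitzFnTD_zero_of_nearFar {R : RenConsts} (hR : ∀ j, 0 ≤ R.Gfr j) {c : ℝ} (hc : 0 < c)
    (hcle : c ≤ klCurveC3 R) {U : ℝ} (hU : 0 < U) (hUle : U ≤ klCurveU0 R) {β : ℝ} (hβmin : klBetaMin ≤ β)
    (hβc : β ≤ Real.exp (c / U ^ 2)) {μ : ℝ} (hμ : μ ∈ klWindowC) {K : TrigPolyC4v} (hK : FrameOK R U (nScales β) μ K)
    (hist : TrigPolyC4v → ℕ → Prop) (G : GeoConsts) (Q : EngConsts) {d b₀ ρ₀ v : ℝ} (hd : 0 < d) (hb₀ : 0 ≤ b₀)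
    (hg₀ : ∀ q : Momentum, |frameLevel μ K q| ≤ d → ‖fderiv ℝ (fun q : Momentum =>
      evalM (symInterp L (klLocSelfEnergyRe L M β U μ K 0)) q - evalM K q) q‖ ≤ b₀)
    (hr₀ : ∀ K' : TrigPolyC4v, FrameOKDeg R U (klTempScaleIdx β klE0) μ K' → frameDist K K' ≤ d → ∀ θ : ℝ,
      |((symInterp L (klLocSelfEnergyRe L M β U μ K 0)).eval (klFermiPoint μ K' θ) - K.eval (klFermiPoint μ K' θ)) -
        ((symInterp L (klLocSelfEnergyRe L M β U μ K' 0)).eval (klFermiPoint μ K' θ) - K'.eval (klFermiPoint μ K' θ))| ≤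
        ρ₀ * frameDist K K')
    (hvK : ∀ θ : ℝ, |(symInterp L (klLocSelfEnergyRe L M β U μ K 0)).eval (klFermiPoint μ K θ) - K.eval (klFermiPoint μ K θ)| ≤ v)
    (hvK' : ∀ K' : TrigPolyC4v, FrameOKDeg R U (klTempScaleIdx β klE0) μ K' → ∀ θ : ℝ,
      |(symInterp L (klLocSelfEnergyRe L M β U μ K' 0)).eval (klFermiPoint μ K' θ) - K'.eval (klFermiPoint μ K' θ)| ≤ v)
    (hfit : ρ₀ + b₀ / klCurveD ≤ lipBar G Q U 0) (hfar : 2 * v ≤ lipBar G Q U 0 * d) :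
    FrameLipschitzFnTD L M hist G Q R β U μ K 0 := by
  intro K' hK' _ q
  have ha : (-4 : ℝ) < -1.1 := by norm_num
  have hab : (-1.1 : ℝ) ≤ -0.1 := by norm_num
  have hb : (-0.1 : ℝ) < 0 := by norm_num
  obtain ⟨hAf, hA20, hADt, hhalf, ⟨hlo, hhi⟩, -, -⟩ := frame_sizes_of_frameOK_explicit hR hc hcle hU hUle hβmin hβc hμ hK
  obtain ⟨hAf', -, -, -, -, -, -⟩ := frame_sizes_of_frameOK_explicit hR hc hcle hU hUle hβmin hβc hμ hK'.1
  have hfd : 0 ≤ frameDist K K' := frameDist_nonneg K K'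
  have hv0 : 0 ≤ v := (abs_nonneg _).trans (hvK 0)
  have hlip : 0 ≤ lipBar G Q U 0 := by nlinarith
  rcases le_or_gt (frameDist K K') d with hnear | hfarK
  · -- near regime
    have hg' : ∀ p : Momentum, |frameLevel μ K p| ≤ frameDist K K' → ‖fderiv ℝ (fun q : Momentum =>
        evalM (symInterp L (klLocSelfEnergyRe L M β U μ K 0)) q - evalM K q) p‖ ≤ b₀ := fun p hp => hg₀ p (hp.trans hnear)
    have hbd := abs_klTwoLegPieceFn_eval_zero_sub_le_near (bandBounds ha hab hb) hAf hAf' hADt hlo hhi hb₀ hg' (hr₀ K' hK' hnear) q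
    have hDpos : 0 < klCurveD := by unfold klCurveD; linarith [cDtmin_window_ge]
    have hden : frameDist K K' / ((bandBounds ha hab hb).Dtmin - 2 * (2 * R.Gfr 0 * |U| + 2 * R.Gfr 1 * U ^ 2 + R.Gfr 2 * (c / Real.log 4))) ≤
        frameDist K K' / klCurveD := div_le_div_of_nonneg_left hfd hDpos hhalf
    calc _ ≤ ρ₀ * frameDist K K' + b₀ * (frameDist K K' /
          ((bandBounds ha hab hb).Dtmin - 2 * (2 * R.Gfr 0 * |U| + 2 * R.Gfr 1 * U ^ 2 + R.Gfr 2 * (c / Real.log 4)))) := hbd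
      _ ≤ ρ₀ * frameDist K K' + b₀ * (frameDist K K' / klCurveD) := by nlinarith [mul_le_mul_of_nonneg_left hden hb₀]
      _ = (ρ₀ + b₀ / klCurveD) * frameDist K K' := by ring
      _ ≤ lipBar G Q U 0 * frameDist K K' := mul_le_mul_of_nonneg_right hfit hfd
  · -- far regime
    have hbd := abs_klTwoLegPieceFn_eval_zero_sub_le_far (bandBounds ha hab hb) hAf hAf' hADt hlo hhi (L := L) (M := M) (β := β) (U := U)
      hvK (hvK' K' hK') q
    calc _ ≤ v + v := hbd
      _ = 2 * v := by ring
      _ ≤ lipBar G Q U 0 * d := hfar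
      _ ≤ lipBar G Q U 0 * frameDist K K' := mul_le_mul_of_nonneg_left hfarK.le hlip

/-- **CAPPED (E3c) AT SCALE `n + 1` IN TWO REGIMES.**  Inputs: a gradient bound `b_Δ` of the increment `evalM S_{n+1}^K − evalM S_n^K` on the tube
`{|frameLevel μ K q| ≤ d}`; the increment response `ρ_Δ·frameDist K K′` at `k_F^{K′}θ` for the NEAR capped comparison frames with history; the VALUE size `v`
of the increment on `K`'s curve and on `K′`'s curve for every capped `K′` with history; `0 < d`; fits `ρ_Δ + b_Δ/klCurveD ≤ lipBar G Q U (n+1)` and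
`2v ≤ lipBar G Q U (n+1) · d` ⇒ `FrameLipschitzFnTD L M hist G Q R β U μ K (n+1)`. -/
theorem frameLipschitzFnTD_succ_of_nearFar {R : RenConsts} (hR : ∀ j, 0 ≤ R.Gfr j) {c : ℝ} (hc : 0 < c)
    (hcle : c ≤ klCurveC3 R) {U : ℝ} (hU : 0 < U) (hUle : U ≤ klCurveU0 R) {β : ℝ} (hβmin : klBetaMin ≤ β)
    (hβc : β ≤ Real.exp (c / U ^ 2)) {μ : ℝ} (hμ : μ ∈ klWindowC) {K : TrigPolyC4v} (hK : FrameOK R U (nScales β) μ K)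
    (hist : TrigPolyC4v → ℕ → Prop) (G : GeoConsts) (Q : EngConsts) (n : ℕ) {d bΔ ρΔ v : ℝ} (hd : 0 < d) (hbΔ : 0 ≤ bΔ)
    (hg : ∀ q : Momentum, |frameLevel μ K q| ≤ d → ‖fderiv ℝ (fun q : Momentum =>
      evalM (symInterp L (klLocSelfEnergyRe L M β U μ K (n + 1))) q - evalM (symInterp L (klLocSelfEnergyRe L M β U μ K n)) q) q‖ ≤ bΔ)
    (hr : ∀ K' : TrigPolyC4v, FrameOKDeg R U (klTempScaleIdx β klE0) μ K' → (∀ j < n + 1, hist K' j) → frameDist K K' ≤ d → ∀ θ : ℝ,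
      |((symInterp L (klLocSelfEnergyRe L M β U μ K (n + 1))).eval (klFermiPoint μ K' θ) -
          (symInterp L (klLocSelfEnergyRe L M β U μ K n)).eval (klFermiPoint μ K' θ)) -
        ((symInterp L (klLocSelfEnergyRe L M β U μ K' (n + 1))).eval (klFermiPoint μ K' θ) -
          (symInterp L (klLocSelfEnergyRe L M β U μ K' n)).eval (klFermiPoint μ K' θ))| ≤ ρΔ * frameDist K K')
    (hvK : ∀ θ : ℝ, |(symInterp L (klLocSelfEnergyRe L M β U μ K (n + 1))).eval (klFermiPoint μ K θ) -
      (symInterp L (klLocSelfEnergyRe L M β U μ K n)).eval (klFermiPoint μ K θ)| ≤ v)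
    (hvK' : ∀ K' : TrigPolyC4v, FrameOKDeg R U (klTempScaleIdx β klE0) μ K' → (∀ j < n + 1, hist K' j) → ∀ θ : ℝ,
      |(symInterp L (klLocSelfEnergyRe L M β U μ K' (n + 1))).eval (klFermiPoint μ K' θ) -
        (symInterp L (klLocSelfEnergyRe L M β U μ K' n)).eval (klFermiPoint μ K' θ)| ≤ v)
    (hfit : ρΔ + bΔ / klCurveD ≤ lipBar G Q U (n + 1)) (hfar : 2 * v ≤ lipBar G Q U (n + 1) * d) :
    FrameLipschitzFnTD L M hist G Q R β U μ K (n + 1) := by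
  intro K' hK' hh q
  have ha : (-4 : ℝ) < -1.1 := by norm_num
  have hab : (-1.1 : ℝ) ≤ -0.1 := by norm_num
  have hb : (-0.1 : ℝ) < 0 := by norm_num
  obtain ⟨hAf, hA20, hADt, hhalf, ⟨hlo, hhi⟩, -, -⟩ := frame_sizes_of_frameOK_explicit hR hc hcle hU hUle hβmin hβc hμ hK
  obtain ⟨hAf', -, -, -, -, -, -⟩ := frame_sizes_of_frameOK_explicit hR hc hcle hU hUle hβmin hβc hμ hK'.1
  have hfd : 0 ≤ frameDist K K' := frameDist_nonneg K K'
  have hv0 : 0 ≤ v := (abs_nonneg _).trans (hvK 0)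
  have hlip : 0 ≤ lipBar G Q U (n + 1) := by nlinarith
  rcases le_or_gt (frameDist K K') d with hnear | hfarK
  · have hg' : ∀ p : Momentum, |frameLevel μ K p| ≤ frameDist K K' → ‖fderiv ℝ (fun q : Momentum =>
        evalM (symInterp L (klLocSelfEnergyRe L M β U μ K (n + 1))) q - evalM (symInterp L (klLocSelfEnergyRe L M β U μ K n)) q) p‖ ≤ bΔ :=
      fun p hp => hg p (hp.trans hnear)
    have hbd := abs_klTwoLegPieceFn_eval_succ_sub_le_near (bandBounds ha hab hb) hAf hAf' hADt hlo hhi hbΔ hg' (hr K' hK' hh hnear) q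
    have hDpos : 0 < klCurveD := by unfold klCurveD; linarith [cDtmin_window_ge]
    have hden : frameDist K K' / ((bandBounds ha hab hb).Dtmin - 2 * (2 * R.Gfr 0 * |U| + 2 * R.Gfr 1 * U ^ 2 + R.Gfr 2 * (c / Real.log 4))) ≤
        frameDist K K' / klCurveD := div_le_div_of_nonneg_left hfd hDpos hhalf
    calc _ ≤ ρΔ * frameDist K K' + bΔ * (frameDist K K' /
          ((bandBounds ha hab hb).Dtmin - 2 * (2 * R.Gfr 0 * |U| + 2 * R.Gfr 1 * U ^ 2 + R.Gfr 2 * (c / Real.log 4)))) := hbd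
      _ ≤ ρΔ * frameDist K K' + bΔ * (frameDist K K' / klCurveD) := by nlinarith [mul_le_mul_of_nonneg_left hden hbΔ]
      _ = (ρΔ + bΔ / klCurveD) * frameDist K K' := by ring
      _ ≤ lipBar G Q U (n + 1) * frameDist K K' := mul_le_mul_of_nonneg_right hfit hfd
  · have hbd := abs_klTwoLegPieceFn_eval_succ_sub_le_far (bandBounds ha hab hb) hAf hAf' hADt hlo hhi (L := L) (M := M) (β := β) (U := U)
      hvK (hvK' K' hK' hh) q
    calc _ ≤ v + v := hbd
      _ = 2 * v := by ring
      _ ≤ lipBar G Q U (n + 1) * d := hfar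
      _ ≤ lipBar G Q U (n + 1) * frameDist K K' := mul_le_mul_of_nonneg_left hfarK.le hlip

end Model

end Summit.HubbardSuperconductivity.HubbardSuperconductivity.Theorems.KLRegimeSplit

end
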